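/-
Origin: expansion seat `planner-pub-hodgecm-mc-axioms-1-g14-0`, handover #W196 2026-08-20T15:53:55Z md5 05f640da799a (PKG 470601391952 → 05f640da799a; 282 l.; MECHANICAL (iib-R) rewrite v3.1 of the PKG file as it stands (65 token edits; rules R1x1+R2x2+RX[h₂]x62)) (`HOME/mc/pub-hodgecm-mc-axioms-1-g14/revendor/kit-r55/stage55/HodgeCM/Model/Binders/Gen12ProjDischarge.lean`, md5 05f640da799a, 282 lines);
landed by the gen-22 packager (p-g22) in gate run 55 REPLACES the earlier landed copy of `HodgeCM/Model/Binders/Gen12ProjDischarge.lean` (seat copy carried the packager Origin header of an earlier run (stripped)).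
-/
/-
Origin: DISCHARGE seat `prover-pub-hodgecm-mc-discharge-1-g16-0` (unit pub-hodgecm-mc-discharge-1-g16, gen 16 of mc-discharge-1, ticket D-1′),
2026-08-19T16:1xZ — revision ⁗ = the RUN-37 (W1) twin of this lineage's RUN-36 kit row #4 `HodgeCM/Model/Binders/Gen12ProjDischarge.lean`
(base af846a50bf0f, kit `mc/pub-hodgecm-mc-discharge-1/t36-mcdischarge1.txt` 7f67011e4b76), cut against glue-1-g6's (W1) `Level`-pair ROOT
PACKET (kit `mc/pub-hodgecm-mc-glue-1-g6/t37-mcglue1g6.txt`: #342 `CM/Basic.lean` 66bed69a8c74, #346 `Model/EmbInstance.lean` ⁗ fa09b2ffb92e)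
and binder-1-g7's ″ re-cut of `Model/Binders/Gen12Junctions.lean` (bf67975d133a; field `Adm` threaded, field `proj` unchanged), per desk
ruling (WWWWW′) 2026-08-19T15:54:56Z (d). TOKEN SUBSTITUTIONS ONLY: `levelOf (Level.isCongruenceSubgroup_coe Γ)` ↦ `Γ.K` (the abbrev
`satSubgroup` and the proof's `Kf`), `isOpen_levelOf (Level.isCongruenceSubgroup_coe Γ)` ↦ `Γ.isOpen_K`, `(arithmeticLevel_levelOf _).le` ↦
`Γ.arithmeticLevel_K.le` (+ two docstrings); every declaration name and statement is otherwise byte-identical (`satSubgroup`, `SatLevel`,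
`Gen12Junctions.proj_of_pieceUnfolding`). Kernel only: 0 `proof-hole`, 0 records, 0 `def … : Prop` beyond the predicate `SatLevel` of the base,
cites nothing; expected `#print axioms` ⊆ {propext, Classical.choice, Quot.sound}. Install AFTER #342–#347 and after the RUN-36 rows it imports.
-/
/-
Origin: DISCHARGE seat `prover-pub-hodgecm-mc-discharge-1-0` (unit pub-hodgecm-mc-discharge-1, ticket D-1′ of `HOME/BINDER-OWNERS.md`:
row 14 `gen12`, sub-items (g2) (J-Λ) `proj` + (j3) `hΛ` level-orbit unfolding; binder-1-g6 consent 2026-08-19T12:40:28Z/12:59:15Z),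
2026-08-19. NEW additive PKG leaf `HodgeCM/Model/Binders/Gen12ProjDischarge.lean` (binder-1-g6's suggested name; path word model1).
Imports binder-1-g6's RUN-36 kit row #2 `Model/Binders/Gen12Junctions` (6db6cb82291f), the installed `Model/Junction/PieceUnfolding`
(RUN 32) and `Model/EmbInstance` IN ITS ‴ REVISION (glue-1-g5 `emb3/EmbInstance.lean` ce5cf2bca8bd, RUN-36 row #340: `emb` at the
UNIFORM Sylvester frame `embFrameOf Γ h`, matrix `V.sylvesterFrame` — ruling (J-x₀)/(J-x₀-emb)), and the vendored twins of the two
tree leaves of this seat, `ShimuraVarieties/UnitaryBallClassLiftWedge` (p188394) and `ShimuraVarieties/UnitaryBallAdelicLiftWedgeJunction`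
(TREE CLAIM #B1), plus period-1's twin #1096 `Automorphic/UnitaryGroupArchSection`. Nothing installed imports this file.
KERNEL ONLY: 0 records, 0 proof holes; one PREDICATE definition (`SatLevel`, the seat's value for the free field `Sat` of
`Gen12Junctions`) and its subgroup; the one junction HYPOTHESIS on the DATA binder `S` is `hι` (the archimedean component of `S` is
the section at `ι₁` in the uniform frame, read in the regime model) — `rfl`-level at the honest `S := archSideOf` of period-1's
`Model/ArchSideInstance` (#1097: `ιinf := archInfOf V = toLatticeModelG ∘ archSectionU21CM … V.sylvesterFrame …`).
Expected `#print axioms`: {propext, Classical.choice, Quot.sound}.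
-/
import Summits.HodgeConjecture.HodgeCM.Model.Binders.Gen12Junctions_2
import Summits.HodgeConjecture.HodgeCM.Model.Junction.PieceUnfolding
import Summits.HodgeConjecture.HodgeCM.Model.Junction.LevelSaturation
import Summits.HodgeConjecture.HodgeCM.Model.EmbInstance_2
import Literature.AlgebraicGeometry.ShimuraVarieties.UnitaryBallClassLiftWedge
import Literature.AlgebraicGeometry.ShimuraVarieties.UnitaryBallAdelicLiftWedgeJunction
import Literature.NumberTheory.Automorphic.UnitaryGroupArchSection

/-!
# (J-Λ) `proj` of `Gen12Junctions`, DISCHARGED by piece unfolding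

E's binder `gen12` is reduced by binder-1's `Model/Binders/Gen12Junctions` to the junction record
`Gen12Junctions hHD hI h₁ h₃ h hA W S μ V c hV = {Sat, rep, seesaw, proj}` at the pin. This file supplies the seat's value of
the free saturation predicate and PROVES the field `proj` at that value:

* `satSubgroup V hV Γ ≤ G_U(𝔸)` (regime model) — the image under `regimeEquiv` of
  `awayFromCM 3 L ι₁ V.Hm ⊓ cmSplitLevel L 3 V.Hm Γ.K`: the compact archimedean factors `Π_{w ≠ w(ι₁)} U(V)(L_w)` times
  the level's own compact open `K_Γ = Γ.K` (the pair `Level = (Γ, K)` of `HodgeCM.CM.Basic`, (W1)); `SatLevel V hV Γ G :≡ G is right-invariant under satSubgroup V hV Γ` (frame-free, `S`-free;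
  it is what (J-rep)'s producer owes for its adelic representatives, cf. BINDER-TRIAGE §54/§56 (J-sat) and theta-3-g8's (Θ-sat-≤)).
* `Gen12Junctions.proj_of_pieceUnfolding (hι)` — the `proj` field of `Gen12Junctions … V c hV` at `Sat := SatLevel V hV`, VERBATIM,
  with `a = 1` and `p = Λ_Γ(cl₁, cl₂)` itself: `⟪Λ_Γ(cl₁, cl₂), realise (G₁ ∧ G₂)⟫ = ⟪Λ, Λ⟫`.

Proof (j3): `Λ_Γ(cl₁, cl₂) = embOf Γ (cl₁ ∪ cl₂) = regimePieceEmb … (principalHolFormLiftCM … (topFormOfClass (cl₁ ∪ cl₂)))`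
(`embOf_apply`, `embAdelicLift_eq`, `adelicHolFormLift_apply` — definitional once the frame is `embFrameOf`); on the principal
piece `M_K · [1]` the realised wedge `realise (G₁ ∧ G₂)` agrees a.e. with the piece lift of that principal-piece function
(tree `UnitaryBallAdelicLiftWedgeJunction.wedge_apply_inv_eq_pieceLift`, fed by (i) `SatLevel`, (ii) the hypotheses
`(D Γ).pull clᵢ = Gᵢ ∘ ιinf` + `hι` + `classMapDatumOf_pull_apply`, (iii) tree `UnitaryBallClassLiftWedge.formPullback₂_topFormOfClass_cup`:
the holomorphic top form of `cl₁ ∪ cl₂` read on the ball is the wedge of the class lifts — emb's frame `embFrameOf Γ h` and the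
pin's `frameOf Γ h` are the SAME frame `⟨V.sylvesterFrame, _⟩`); then the single-piece unfolding `QuotientModel.inner_pieceEmb_left`
(`Junction/PieceUnfolding`) and `pieceDescend_pieceLift` give `⟪Λ, v⟫ = ∫ ⟪f, f⟫ = ⟪Λ, Λ⟫` (`inner_regimePieceEmb`).

ABSOLUTE RULE honoured: nothing cited, nothing minted; MODEL-N ±0; E text untouched.
-/

set_option autoImplicit false

noncomputable section

open scoped InnerProductSpace Matrix
open MeasureTheory MulAction Literature.MeasureTheory.Group
open Literature.NumberTheory.Automorphic Literature.NumberTheory.Automorphic.UnitaryGroup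
open Literature.NumberTheory.Automorphic.LevelOrbit
open Literature.Geometry.ComplexHyperbolic.BallModel (U21 Ball x₀ Jac)
open Literature.AlgebraicGeometry.ShimuraVarieties
open NumberField

namespace HodgeCM

namespace Model

open Literature.AlgebraicGeometry.HodgeTheory
open Literature.NumberTheory.Automorphic.PicardCM
open Literature.NumberTheory.Transcendental (Arapura2012_Cor_15_4_6)

variable (hHD : exists_isReal_hodgeModel) (hI : hodgePQ_independent_of_hodgeModel)
  (h₁ : BallQuotientUniformised)  (h₃ : CMAbelianVarietyRealised)
variable (h : Bool) (hA : Arapura2012_Cor_15_4_6)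
  (W : ∀ {L : CMField} {ι₁ : L →+* ℂ} (V : HermSpace3 L ι₁) (c : SeesawCtx L), WmInput V c.D)
  (S : ∀ {L : CMField} {ι₁ : L →+* ℂ} (V : HermSpace3 L ι₁) (c : SeesawCtx L), ThetaAdelicSide V c)
  (μ : ∀ {L : CMField}, SeesawCtx L → Fin 4 → InfinitePlace L → ℤ)

variable {L : CMField} {ι₁ : L →+* ℂ} (V : HermSpace3 L ι₁) (c : SeesawCtx L) (hV : IsAnisotropic L V.Hm)

/-! ## 1. The saturation predicate of record -/

/-- **The saturation subgroup at level `Γ`** (regime model of `G_U(𝔸)`): `satLevelRegimeOf V hV Γ.K` of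
`Model/Junction/LevelSaturation` — the image under `regimeEquiv` of `awayFromCM 3 L ι₁ V.Hm ⊓ cmSplitLevel L 3 V.Hm Γ.K`,
the compact archimedean factors `Π_{w ≠ w(ι₁)} U(V)(L_w)` of `U(V)(L ⊗ ℝ)` times the level's own compact open `K_Γ = Γ.K ≤ U(V)(𝔸_{L⁺,f})`
(the pair `Level = (Γ, K)` of `HodgeCM.CM.Basic`, (W1); emb's piece level). Frame-free and independent of the data binder `S`. -/
abbrev satSubgroup (Γ : Level V) : Subgroup (quotU V).G :=
  satLevelRegimeOf V hV Γ.K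

/-- **`SatLevel Γ G`** — the seat's value of the free field `Sat` of `Gen12Junctions`: the adelic representative `G` (a left-`G_U(L⁺)`-
invariant `ℂ²`-valued function on the regime model of `G_U(𝔸)`) is RIGHT-invariant under `satSubgroup V hV Γ`. This is what the
(J-rep) producer owes for its representatives (saturation at emb's level + invariance under the compact archimedean factors). -/
def SatLevel (Γ : Level V) (G : (quotU V).leftInvCont₂) : Prop :=
  ∀ g : (quotU V).G, ∀ k ∈ satSubgroup V hV Γ,
    (G : (quotU V).G → (Fin 2 → ℂ)) (g * k) = (G : (quotU V).G → (Fin 2 → ℂ)) g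

/-! ## 2. The `proj` field, discharged -/

set_option maxHeartbeats 1600000 in
/-- **(J-Λ) `proj` at `Sat := SatLevel`, from piece unfolding.** The one junction hypothesis `hι` says that the archimedean component
`(S V c).ιinf` of the DATA binder `S` is the section at `ι₁` in the uniform Sylvester frame `V.sylvesterFrame`, read in the regime model
(`rfl`-level at period-1's honest `S := archSideOf V c`, whose `ιinf := archInfOf V`). Conclusion = the field `Gen12Junctions.proj`
VERBATIM at `Sat := SatLevel V hV`, with `a = 1`, `p = Λ_Γ(cl₁, cl₂)`. -/
theorem Gen12Junctions.proj_of_pieceUnfolding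
    (hι : ∀ u : U21, (S V c).ιinf u =
      Adelic.regimeEquiv L V.Hm hV (archSectionU21CM (L : Type) ι₁ V.Hm V.sylvesterFrame (sylvesterFrame_J V) u)) :
    ∀ (Γ : Level V) (cl₁ cl₂ : ((pinX hHD hI h₁ h₃ S V c hV).D Γ).H10) (G₁ G₂ : (quotU V).leftInvCont₂),
      SatLevel V hV Γ G₁ → SatLevel V hV Γ G₂ →
      ((((pinX hHD hI h₁ h₃ S V c hV).D Γ).pull cl₁).1 : (pinX hHD hI h₁ h₃ S V c hV).G₁ → (Fin 2 → ℂ)) =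
        (G₁ : (quotU V).G → (Fin 2 → ℂ)) ∘ ((pinX hHD hI h₁ h₃ S V c hV).ιinf Γ) →
      ((((pinX hHD hI h₁ h₃ S V c hV).D Γ).pull cl₂).1 : (pinX hHD hI h₁ h₃ S V c hV).G₁ → (Fin 2 → ℂ)) =
        (G₂ : (quotU V).G → (Fin 2 → ℂ)) ∘ ((pinX hHD hI h₁ h₃ S V c hV).ιinf Γ) →
      ∃ (a : ℂ) (p : (pinT hHD hI h₁ h₃ h hA W S μ).HG L ι₁ V), a ≠ 0 ∧
        (pinT hHD hI h₁ h₃ h hA W S μ).Λ Γ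
            (cl₁ : (picardCMUniverse hHD hI h₁ h₃).CohC ((picardCMUniverse hHD hI h₁ h₃).pms L ι₁ V Γ) 1)
            (cl₂ : (picardCMUniverse hHD hI h₁ h₃).CohC ((picardCMUniverse hHD hI h₁ h₃).pms L ι₁ V Γ) 1) = a • p ∧
        ⟪p, (quotU V).realise ((quotU V).wedge₂ G₁ G₂)⟫_ℂ = ⟪p, p⟫_ℂ := by
  intro Γ cl₁ cl₂ G₁ G₂ hS₁ hS₂ hp₁ hp₂
  refine ⟨1, (pinT hHD hI h₁ h₃ h hA W S μ).Λ Γ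
      (cl₁ : (picardCMUniverse hHD hI h₁ h₃).CohC ((picardCMUniverse hHD hI h₁ h₃).pms L ι₁ V Γ) 1)
      (cl₂ : (picardCMUniverse hHD hI h₁ h₃).CohC ((picardCMUniverse hHD hI h₁ h₃).pms L ι₁ V Γ) 1),
    one_ne_zero, (one_smul ℂ _).symm, ?_⟩
  /- ### the data of the principal piece at level `Γ` (emb's own terms, tree spelling) -/
  set Kf := Γ.K with hKf
  have hKo := Γ.isOpen_K
  set M : Subgroup ↥(Literature.NumberTheory.Automorphic.adelicUnitaryGroup (L : Type) V.Hm) :=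
    cmSplitLevel (L : Type) 3 V.Hm Kf with hM
  set π := cmSplitProj (L : Type) 3 V.Hm Kf with hπ
  have hMo : IsOpen (M : Set ↥(Literature.NumberTheory.Automorphic.adelicUnitaryGroup (L : Type) V.Hm)) :=
    isOpen_cmSplitLevel (L : Type) 3 V.Hm Kf hKo
  have hπc : Continuous π := continuous_cmSplitProj (L : Type) 3 V.Hm Kf
  have hπs : Function.Surjective π := splitProj_surjective _ _
  haveI hcpt : CompactSpace (arch (↥(maximalRealSubfield L)) L (IsCMField.complexConj L) 3 V.Hm ⧸
      pieceLattice M (adelicUnitaryRat (L : Type) V.Hm) π (cmPrincipalPoint (L : Type) 3 V.Hm)) :=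
    compactSpace_arch_quotient_cmPrincipalLattice_of_anisotropic (L : Type) 3 V.Hm Kf (hanis_of_isAnisotropic hV) hKo
  -- the regime transport to the quotient model
  set e : ↥(Literature.NumberTheory.Automorphic.adelicUnitaryGroup (L : Type) V.Hm) ≃ₜ* (quotU V).G :=
    Adelic.regimeEquiv L V.Hm hV with he
  have hΓe : ∀ g, e g ∈ (quotU V).Γ ↔ g ∈ adelicUnitaryRat (L : Type) V.Hm :=
    V.regimeEquiv_mem_latticeModel_Γ_iff printFact_unitaryCompact_holds hV
  -- emb's datum, Hodge model, frame, realising data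
  set D := embDatum h₁ h₃ Γ hV with hD
  set A := embHodgeModel hHD h₁ h₃ Γ with hAdef
  set 𝔣 := embFrameOf h₁ h₃ Γ hV with h𝔣
  have hH : V.Hm.map ι₁ = D.H.map D.E.subtype :=
    map_Hm_eq_ballDatum_H_map (ballQuotientUniformisedDatum_of h₁) h₃ Γ ((isAnisotropic_pmsCode_iff L ι₁ V Γ).2 hV)
  have hK : arithmeticLevel (↥(maximalRealSubfield L)) L (IsCMField.complexConj L) 3 V.Hm Kf ≤ Γ.Γ :=
    Γ.arithmeticLevel_K.le
  have hΓ₀ := map_Γ_le_ballDatum (ballQuotientUniformisedDatum_of h₁) h₃ Γ ((isAnisotropic_pmsCode_iff L ι₁ V Γ).2 hV)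
  -- the cup product, its holomorphic top form, its principal-piece function, and the piece lift of the latter
  set η : (picardCMUniverse hHD hI h₁ h₃).CohC ((picardCMUniverse hHD hI h₁ h₃).pms L ι₁ V Γ) 2 :=
    (picardCMUniverse hHD hI h₁ h₃).cup2C ((picardCMUniverse hHD hI h₁ h₃).pms L ι₁ V Γ) 1
      (cl₁ : (picardCMUniverse hHD hI h₁ h₃).CohC ((picardCMUniverse hHD hI h₁ h₃).pms L ι₁ V Γ) 1)
      (cl₂ : (picardCMUniverse hHD hI h₁ h₃).CohC ((picardCMUniverse hHD hI h₁ h₃).pms L ι₁ V Γ) 1) with hη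
  set α := embTopForm hHD hI h₁ h₃ Γ η with hα
  set f := D.principalHolFormLiftCM A 𝔣 L V.Hm ι₁ hH Kf hK hΓ₀ α with hf
  /- ### Step 1: `Λ_Γ(cl₁, cl₂)` is the piece embedding of `f` -/
  have hΛ : (pinT hHD hI h₁ h₃ h hA W S μ).Λ Γ
      (cl₁ : (picardCMUniverse hHD hI h₁ h₃).CohC ((picardCMUniverse hHD hI h₁ h₃).pms L ι₁ V Γ) 1)
      (cl₂ : (picardCMUniverse hHD hI h₁ h₃).CohC ((picardCMUniverse hHD hI h₁ h₃).pms L ι₁ V Γ) 1) =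
      (quotU V).pieceEmb (adelicUnitaryRat (L : Type) V.Hm) e hΓe M π (cmPrincipalPoint (L : Type) 3 V.Hm) hMo hπc f := by
    rw [Universe.ThetaModel.Λ_apply]
    change embOf hHD hI h₁ h₃ Γ η = _
    rw [embOf_apply hHD hI h₁ h₃ Γ hV]
    rfl
  /- ### Step 2: the realised wedge agrees with the piece lift of `f` on the principal piece -/
  -- tree-side representatives
  have hsat : ∀ (G : (quotU V).leftInvCont₂), SatLevel V hV Γ G →
      ∀ g : ↥(Literature.NumberTheory.Automorphic.adelicUnitaryGroup (L : Type) V.Hm),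
        ∀ k ∈ awayFromCM 3 (L : Type) ι₁ V.Hm ⊓ cmSplitLevel (L : Type) 3 V.Hm Kf,
          (fun x => (G : (quotU V).G → (Fin 2 → ℂ)) (e x)) (g * k) =
            (fun x => (G : (quotU V).G → (Fin 2 → ℂ)) (e x)) g := by
    intro G hG g k hk
    exact (congrArg (fun t => (G : (quotU V).G → (Fin 2 → ℂ)) t) (map_mul e g k)).trans
      (hG (e g) (e k) (Subgroup.mem_map_of_mem (Adelic.regimeEquiv L V.Hm hV).toMonoidHom hk))
  have hpull : ∀ (cl : ((pinX hHD hI h₁ h₃ S V c hV).D Γ).H10) (G : (quotU V).leftInvCont₂),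
      ((((pinX hHD hI h₁ h₃ S V c hV).D Γ).pull cl).1 : U21 → (Fin 2 → ℂ)) =
        (G : (quotU V).G → (Fin 2 → ℂ)) ∘ ((pinX hHD hI h₁ h₃ S V c hV).ιinf Γ) →
      ∀ u : U21, (fun x => (G : (quotU V).G → (Fin 2 → ℂ)) (e x))
          (archSectionU21CM (L : Type) ι₁ V.Hm 𝔣.T (𝔣.conjTranspose_mul_map_mul V.Hm ι₁ hH) u) =
        (Jac u x₀)ᵀ *ᵥ D.classLift hHD 𝔣
          (cl : (picardCMUniverse hHD hI h₁ h₃).CohC ((picardCMUniverse hHD hI h₁ h₃).pms L ι₁ V Γ) 1) (u • x₀) := by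
    intro cl G hp u
    have hc : (G : (quotU V).G → (Fin 2 → ℂ)) ((S V c).ιinf u) =
        ((((pinX hHD hI h₁ h₃ S V c hV).D Γ).pull cl).1 : U21 → (Fin 2 → ℂ)) u := by
      rw [hp]; rfl
    have hι' : (S V c).ιinf u = e (archSectionU21CM (L : Type) ι₁ V.Hm 𝔣.T (𝔣.conjTranspose_mul_map_mul V.Hm ι₁ hH) u) :=
      hι u
    change (G : (quotU V).G → (Fin 2 → ℂ))
        (e (archSectionU21CM (L : Type) ι₁ V.Hm 𝔣.T (𝔣.conjTranspose_mul_map_mul V.Hm ι₁ hH) u)) = _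
    rw [← hι', hc]
    exact classMapDatumOf_pull_apply hHD hI h₁ h₃ Γ hV (frameOf hHD hI h₁ h₃ Γ hV) (MonoidHom.id U21) _ _ cl u
  have hc₁ : (cl₁ : (picardCMUniverse hHD hI h₁ h₃).CohC ((picardCMUniverse hHD hI h₁ h₃).pms L ι₁ V Γ) 1) ∈
      (BettiUniverse.hodge hHD (isSmoothProjective_pms h₁ h₃ Γ) 1).F 1 := cl₁.2
  have hc₂ : (cl₂ : (picardCMUniverse hHD hI h₁ h₃).CohC ((picardCMUniverse hHD hI h₁ h₃).pms L ι₁ V Γ) 1) ∈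
      (BettiUniverse.hodge hHD (isSmoothProjective_pms h₁ h₃ Γ) 1).F 1 := cl₂.2
  have hwedge : ∀ z : Ball, D.formPullback₂ A 𝔣 α.1 z =
      D.classLift hHD 𝔣
          (cl₁ : (picardCMUniverse hHD hI h₁ h₃).CohC ((picardCMUniverse hHD hI h₁ h₃).pms L ι₁ V Γ) 1) z 0 *
        D.classLift hHD 𝔣
          (cl₂ : (picardCMUniverse hHD hI h₁ h₃).CohC ((picardCMUniverse hHD hI h₁ h₃).pms L ι₁ V Γ) 1) z 1 -
      D.classLift hHD 𝔣
          (cl₁ : (picardCMUniverse hHD hI h₁ h₃).CohC ((picardCMUniverse hHD hI h₁ h₃).pms L ι₁ V Γ) 1) z 1 *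
        D.classLift hHD 𝔣
          (cl₂ : (picardCMUniverse hHD hI h₁ h₃).CohC ((picardCMUniverse hHD hI h₁ h₃).pms L ι₁ V Γ) 1) z 0 :=
    fun z => D.formPullback₂_topFormOfClass_cup hHD 𝔣 hI
      ((embHodgeModel hHD h₁ h₃ Γ).topHolFormClassPQ_bijective (isSmoothProjective_pms h₁ h₃ Γ)) hc₁ hc₂ z
  -- the pointwise identity on the piece (tree junction lemma #B1)
  have hpt := D.wedge_apply_inv_eq_pieceLift A 𝔣 L V.Hm ι₁ hH Kf hK hΓ₀
    (fun x => (G₁ : (quotU V).G → (Fin 2 → ℂ)) (e x)) (fun x => (G₂ : (quotU V).G → (Fin 2 → ℂ)) (e x)) _ _ α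
    (hsat G₁ hS₁) (hsat G₂ hS₂) (hpull cl₁ G₁ hp₁) (hpull cl₂ G₂ hp₂) hwedge
  -- a.e. agreement of the realised wedge with the piece lift of `f` on the piece
  have hvu : ∀ᵐ y ∂((quotU V).pullbackν (adelicUnitaryRat (L : Type) V.Hm) e hΓe),
      y ∈ MulAction.orbit M (cmPrincipalPoint (L : Type) 3 V.Hm) →
      (((quotU V).realise ((quotU V).wedge₂ G₁ G₂) : (quotU V).H) : (quotU V).G ⧸ (quotU V).Γ → ℂ)
          (cosetCongr e.toMulEquiv (adelicUnitaryRat (L : Type) V.Hm) (quotU V).Γ hΓe y) =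
        pieceLift M (adelicUnitaryRat (L : Type) V.Hm) π (cmPrincipalPoint (L : Type) 3 V.Hm) f y := by
    have hae := ((quotU V).measurePreserving_cosetCongr_pullbackν (adelicUnitaryRat (L : Type) V.Hm) e
      hΓe).quasiMeasurePreserving.ae_eq_comp
        (ContinuousMap.coeFn_toLp (E := ℂ) (p := 2) (μ := (quotU V).ν) (𝕜 := ℂ)
          ((quotU V).descendInv ((quotU V).wedge₂ G₁ G₂)))
    filter_upwards [hae] with y hy hmem
    rw [QuotientModel.realise_apply]
    refine hy.trans ?_
    obtain ⟨m, rfl⟩ := MulAction.mem_orbit_iff.1 hmem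
    refine Eq.trans ?_ (hpt m)
    have hmx : ((m • cmPrincipalPoint (L : Type) 3 V.Hm :
        ↥(Literature.NumberTheory.Automorphic.adelicUnitaryGroup (L : Type) V.Hm) ⧸ adelicUnitaryRat (L : Type) V.Hm)) =
        QuotientGroup.mk (m : ↥(Literature.NumberTheory.Automorphic.adelicUnitaryGroup (L : Type) V.Hm)) := by
      change QuotientGroup.mk ((m : ↥(Literature.NumberTheory.Automorphic.adelicUnitaryGroup (L : Type) V.Hm)) * 1) = _
      rw [mul_one]
    change (quotU V).descendInv ((quotU V).wedge₂ G₁ G₂)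
        (cosetCongr e.toMulEquiv (adelicUnitaryRat (L : Type) V.Hm) (quotU V).Γ hΓe (m • cmPrincipalPoint (L : Type) 3 V.Hm)) = _
    rw [hmx, cosetCongr_mk, QuotientModel.descendInv_mk, QuotientModel.coe_wedge₂, QuotientModel.wedge₂Fun_apply]
    change _ = (G₁ : (quotU V).G → (Fin 2 → ℂ)) (e (m : ↥(Literature.NumberTheory.Automorphic.adelicUnitaryGroup (L : Type) V.Hm))⁻¹) 0 *
        (G₂ : (quotU V).G → (Fin 2 → ℂ)) (e (m : ↥(Literature.NumberTheory.Automorphic.adelicUnitaryGroup (L : Type) V.Hm))⁻¹) 1 -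
      (G₁ : (quotU V).G → (Fin 2 → ℂ)) (e (m : ↥(Literature.NumberTheory.Automorphic.adelicUnitaryGroup (L : Type) V.Hm))⁻¹) 1 *
        (G₂ : (quotU V).G → (Fin 2 → ℂ)) (e (m : ↥(Literature.NumberTheory.Automorphic.adelicUnitaryGroup (L : Type) V.Hm))⁻¹) 0
    rw [map_inv]
    rfl
  have hu_inv : ∀ n : M, π n = 1 → ∀ y,
      pieceLift M (adelicUnitaryRat (L : Type) V.Hm) π (cmPrincipalPoint (L : Type) 3 V.Hm) f (n • y) =
        pieceLift M (adelicUnitaryRat (L : Type) V.Hm) π (cmPrincipalPoint (L : Type) 3 V.Hm) f y := fun n hn y =>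
    pieceLift_smul_of_map_eq_one M (adelicUnitaryRat (L : Type) V.Hm) π (cmPrincipalPoint (L : Type) 3 V.Hm) f n hn y
  have hum : AEStronglyMeasurable
      (pieceDescend M (adelicUnitaryRat (L : Type) V.Hm) π hπs (cmPrincipalPoint (L : Type) 3 V.Hm)
        (pieceLift M (adelicUnitaryRat (L : Type) V.Hm) π (cmPrincipalPoint (L : Type) 3 V.Hm) f))
      (pieceMeasure M (adelicUnitaryRat (L : Type) V.Hm) π (cmPrincipalPoint (L : Type) 3 V.Hm)
        ((quotU V).pullbackν (adelicUnitaryRat (L : Type) V.Hm) e hΓe)) := by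
    rw [pieceDescend_pieceLift]
    exact f.continuous.aestronglyMeasurable
  /- ### Step 3: unfolding -/
  rw [hΛ]
  change ⟪(quotU V).pieceEmb (adelicUnitaryRat (L : Type) V.Hm) e hΓe M π (cmPrincipalPoint (L : Type) 3 V.Hm) hMo hπc f,
      (quotU V).realise ((quotU V).wedge₂ G₁ G₂)⟫_ℂ =
    ⟪(quotU V).pieceEmb (adelicUnitaryRat (L : Type) V.Hm) e hΓe M π (cmPrincipalPoint (L : Type) 3 V.Hm) hMo hπc f,
      (quotU V).pieceEmb (adelicUnitaryRat (L : Type) V.Hm) e hΓe M π (cmPrincipalPoint (L : Type) 3 V.Hm) hMo hπc f⟫_ℂ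
  rw [(quotU V).inner_pieceEmb_left (adelicUnitaryRat (L : Type) V.Hm) e hΓe M π hπs
    (cmPrincipalPoint (L : Type) 3 V.Hm) hMo hπc f _ hu_inv hvu hum,
    (quotU V).inner_pieceEmb (adelicUnitaryRat (L : Type) V.Hm) e hΓe M π
    (cmPrincipalPoint (L : Type) 3 V.Hm) hMo hπc f f]
  simp_rw [pieceDescend_pieceLift]

end Model

end HodgeCM

end
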